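import Summits.CriticalPhenomena.PercolationContinuityZ3.Theorems.Transplant.SkelPhiRouteDatumS
import HarnessLib

/-!
# D″ node, LEVEL 1 (c) closed up: the TWO-SCALE KIT CLAUSE OF A WINDOW LEVEL FROM THE STEP-I′ CERTIFICATE — `Skelφ.kitClause'` with its
# per-contact hypothesis `hcon'` DISCHARGED by `Skelφ.kitCon_stepIS` (route datum, schedule form) and its zone-family room `hkn`/`hΛρ` by
# `Skelφ.fatSeqOff_kit_room` (`Λc := D.Λ = fatSeqOff off`, `kz := D.k`, `n := Mz`, `ρ := ψ Mz + off`): ONE call per level `j` of a chain step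
# for every consumer of the schedule-generic window chain (`SkelPhiWinChainS.kitsAt_stepA`'s `hkits`) — root chain (R), face-step inner
# routes (F), corridor chains (C)

builds on p205010 (kernel theorem, internal audit signed; external expert review pending) — nothing in this file uses p205010.
Lane `prim-bschramm`, seat `prim-bschramm-p1` (gen 9); helper file (`--supports stmt-CriticalPhenomena-4575 --as helper`).
* **`kitClause_stepI`**.
[cite: KozmaNitzan2024, §4 Lemma 10, Steps III–V (pp. 19–22), Lemma 11 (pp. 22–23)]
-/

noncomputable section

open scoped Classical

namespace Summit.CriticalPhenomena.PercolationContinuityZ3.Theorems.Transplant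

namespace Skelφ

open MeasureTheory
open Literature.Probability.Percolation Literature.Probability.LatticeModels SimpleGraph KNLevels
open Literature.Barriers.CriticalPhenomena (graphBall graphBall_finite mem_graphBall_self graphBall_mono)
open Skel (winGraph winGraph_adj winGraph_le KitGeom)
open SkelI (tanOff)
open Literature.Probability.Percolation.KozmaNitzan.Cells (oth oth_ne eq_oth_of_ne oth_oth)

variable {V : Type} [DecidableEq V] {G : SimpleGraph V} [G.LocallyFinite] {φ : V → Site 2} {types : Finset V}
  {w₀ : V} {R : ℕ} {lo hi : Site 2} {j ℓs M K : ℕ} {A : Fin 2 → Fin 2 → ℕ} {Rk : Fin 2 → ℕ}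

/-- **THE TWO-SCALE KIT CLAUSE OF THE WINDOW LEVEL `j` FROM THE STEP-I′ CERTIFICATE.** Dictionary hypotheses, the degree bound, the Step-I′
certificate at the running density `q` with threshold `1 − δ²` (data `D` over `fatSeqOff off`), the kit (zone scale `Mz ∈ Sz` above the seed
level `D.k`, certified extents `ℓK`, half-widths `A I = widths (ℓK I)`, radii `Rk I = D.R (amax (A I))`) with the slab/shell rooms of
`kitClause'` (`n := Mz`, `ρ := ψ Mz + off`), the route along `ax` (certified extents `[ℓ₀, ℓ₁]` beyond `Mz`, depth, band spread `Wr`, the planar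
room at every point of the level box with region `Preg` / core `Pcore`), the windows over the room inside the region `D` / the target `T`, far
inner neighbours inside `T`, the subbox weighting `Wt` of the window graph on `D ⊇` the level, the count `N` and the kit number `k` ⟹ the kit
clause of level `j` towards `T` inside `D` (the `hkits` of `Skelφ.WinChainData.kitsAt_stepA` at `G' = winGraph G w₀ R`).
[cite: KozmaNitzan2024, §4 Lemma 10, Steps III–V (pp. 19–22), Lemma 11 (pp. 22–23)] -/
theorem kitClause_stepI [Countable V] (hlip : Lip G φ) (hstep : Steps G φ) (hfr : Frames G φ types) (hκ : CylConn G φ types) {Δ : ℕ}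
    (hΔ : ∀ v, G.degree v ≤ Δ) {p : unitInterval} (hC : CylSubcritical G φ types p) {D : StepI.Data V} {off : ℕ}
    (hD : D.Λ = fatSeqOff hfr hC off) {Sz Sx Sy : Finset ℕ} {q : unitInterval} {δ : ℝ} (hδ : 0 < δ)
    (h : ∀ i ∈ StepI.index types Sz Sx Sy, 1 - δ ^ 2 < (bondPercolation G q).real (StepI.event G φ D i))
    -- the kit: zone scale, certified extents, half-widths, radii
    {Mz : ℕ} (hMz : Mz ∈ Sz) (hkz : D.k ≤ Mz) {ℓK : Fin 2 → ℕ} (hℓK0 : ∀ I, I = 0 → ℓK I ∈ Sx) (hℓK1 : ∀ I, I = 1 → ℓK I ∈ Sy)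
    (hAw : ∀ I, A I = StepI.widths D.Gb D.Fb I (ℓK I)) (hRk : ∀ I, Rk I = D.R (amax (A I)))
    -- the slab and shell rooms of `kitClause'`
    {R' r₀ rs : ℕ} (hℓs : 1 ≤ ℓs) (hwide : ∀ i, (lo - (j : Site 2)) i + 2 * tanOff ℓs M ≤ (hi + (j : Site 2)) i)
    (hA : ∀ i k, A i k ≤ M) (hAℓ : ∀ i, A i (oth i) ≤ ℓs) (hK : ∀ i, ℓs + 1 + A i i + Rk i ≤ K)
    (hnA : ∀ i, Mz + 1 ≤ A i i) (hnM : Mz ≤ M) (hρK : ∀ i, ℓs + 1 + A i i + (fatRadius hfr hC Mz + off) ≤ K)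
    (hR'₁ : cylRadMax G φ types ℓs (ℓs + 2 + 2 * tanOff ℓs M) ≤ R') (hR'₂ : ∀ i, cylRadMax G φ types ℓs (ℓs + 2 + A i i + Rk i) ≤ R')
    (hr₀₁ : ℓs + 1 + tanOff ℓs M + R' ≤ r₀) (hr₀₂ : ℓs + 2 + tanOff ℓs M + K ≤ r₀) (hR : r₀ ≤ R)
    (hrs₁ : ℓs + 2 + tanOff ℓs M + R' ≤ rs) (hrs₂ : ℓs + 2 + tanOff ℓs M + K ≤ rs) {cU : ℕ} (hcU : ∀ i, (Δ + 1) ^ Rk i ≤ cU)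
    -- the route: axis, certified extents beyond the zone scale, depth, band spread
    (ax : Fin 2) {ℓ₀ ℓ₁ : ℕ} (hMℓ : Mz + 1 ≤ ℓ₀)
    (hS0 : ax = 0 → ∀ ℓ, ℓ₀ ≤ ℓ → ℓ ≤ ℓ₁ → ℓ ∈ Sx) (hS1 : ax = 1 → ∀ ℓ, ℓ₀ ≤ ℓ → ℓ ≤ ℓ₁ → ℓ ∈ Sy)
    (hdepth : ∀ I ℓ, ℓ₀ ≤ ℓ → ℓ ≤ ℓ₁ → 2 * ℓs + 2 + tanOff ℓs M + A I I + D.R (amax (StepI.widths D.Gb D.Fb ax ℓ)) ≤ r₀)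
    {Wr : ℕ → ℕ} (hWr : ∀ ℓ, ℓ₀ ≤ ℓ → ℓ ≤ ℓ₁ → StepI.widths D.Gb D.Fb ax ℓ (oth ax) ≤ Wr ℓ)
    -- the planar room at every point of the level box
    {Preg Pcore : Finset (Site 2)}
    (hroom : ∀ v ∈ Finset.Icc (lo - (j : Site 2)) (hi + (j : Site 2)), ∃ ℓ : ℕ, ℓ₀ ≤ ℓ ∧ ℓ ≤ ℓ₁ ∧
      ∃ σ : ℤ, (σ = 1 ∨ σ = -1) ∧
        (∀ y : Site 2, |y ax - v ax| ≤ ℓ → |y (oth ax) - v (oth ax)| ≤ Wr ℓ → y ∈ Preg) ∧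
        ∃ τ : ℤ, (τ = 1 ∨ τ = -1) ∧ ∀ y : Site 2, y ax - v ax = σ * ℓ → 0 ≤ τ * (y (oth ax) - v (oth ax)) →
          |y (oth ax) - v (oth ax)| ≤ Wr ℓ → y ∈ Pcore)
    -- the level's kit number, source, support; the region, the target, the weighting, the count
    (k : ℕ) (o : V) (Sfin : Finset V) {Wt : Sym2 V → unitInterval} {Dr T : Finset V}
    (hWD : IsSubbox (winGraph G w₀ R) Wt q Dr) (hXD : winLevel G φ w₀ R lo hi j ⊆ Dr)
    (hPD : Win G φ w₀ Preg R ⊆ Dr) (hPT : Win G φ w₀ Pcore R ⊆ T)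
    (hfarT : ∀ x ∈ outerBoundary (winGraph G w₀ R) (winLevel G φ w₀ R lo hi j),
      inNbr G φ w₀ R (Finset.Icc (lo - (j : Site 2)) (hi + (j : Site 2))) x ∉ graphBall G w₀ (R - r₀) →
      inNbr G φ w₀ R (Finset.Icc (lo - (j : Site 2)) (hi + (j : Site 2))) x ∈ T)
    {N : ℕ} (hN : k * (Δ + 1) ^ (2 * rs) ≤ N)
    (hk : (1 - (q : ℝ) ^ (1 + Δ * ((Δ + 1) ^ R' + (tanOff ℓs M + 2)) + ((Δ + 1) ^ R' + (tanOff ℓs M + 2)) * cU)) ^ k ≤ δ) :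
    ∃ (σ : SData V) (S : Finset V), SHyp (winLData G φ w₀ R lo hi o Sfin) j σ ∧ σ.N ≤ N ∧
      (1 - (q : ℝ) ^ σ.sB) ^ σ.k ≤ δ ∧ S ⊆ (winLData G φ w₀ R lo hi o Sfin).X j ∧ S ⊆ Dr ∧
      (∀ x ∈ σ.K, ∀ e ∈ σ.seed x, e ∉ wireSet (↑S : Set V)) ∧ (∀ x ∈ σ.K, σ.face x ⊆ S) ∧
      (∀ x ∈ σ.K, 1 - 3 * δ ≤ (prodBernoulli Wt).real {ω | ∃ u ∈ σ.face x,
        1 - δ < (prodBernoulli (pinW Wt (wireSet (↑S : Set V)) ω)).real (⋃ t ∈ T, openConnIn (↑Dr : Set V) u t)}) := by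
  obtain ⟨hkn, hΛρ⟩ := fatSeqOff_kit_room (G := G) (φ := φ) hfr hC off hkz
  rw [← hD] at hkn hΛρ
  have hcon := kitCon_stepIS hlip hstep hfr hC hD h hMz hℓK0 hℓK1 hAw hRk hwide hA hK (le_trans (by omega) hr₀₂) hR ax hMℓ hS0 hS1
    hdepth hWr hroom hPD hPT hWD hfarT R'
  exact kitClause' hlip hstep hfr hκ hΔ hδ hℓs hwide hA hAℓ hK D.Λ hkn hΛρ hnA hnM hρK hR'₁ hR'₂ hr₀₁ hr₀₂ hR hrs₁ hrs₂ hcU k o Sfin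
    hWD hXD hN hk hcon

end Skelφ

end Summit.CriticalPhenomena.PercolationContinuityZ3.Theorems.Transplant

end
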